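import Summits.ValiantsHypothesis.ValiantsHypothesis.Theses.ProofCarryingSymmetry
import Summits.ValiantsHypothesis.ValiantsHypothesis.Theses.MonotoneRestoration

/-!
# STRATEGY-CENSUS s11 — typed attempts (planner cstrat seat s11, independent family `s`)

Signatures backing `Cruxes/RestorationQP/STRATEGY-CENSUS-s11.md`.  Defs only carry content;
the theorems below are the (short) kernel-checked relations between the attempts and the crux /
the summit that the census cites.  Nothing here is a route item.
-/

open Literature.Computability.AlgebraicComplexity

namespace Summit.ValiantsHypothesis.ValiantsHypothesis.Cruxes.RestorationQP.CensusS11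

open Summit.ValiantsHypothesis.ValiantsHypothesis.Theses

/-! ## Strengthen: S⁺ = pointwise (non-uniform, per-circuit) restoration -/

/-- S⁺ (strengthen attempt): every circuit of size `s` computing an `S_n`-invariant polynomial
`p` of total degree `d` on the `n × n` variable matrix has an `S_n`-symmetric equivalent of size
quasi-polynomial in `s + d + n`, with ONE universal exponent `c`.  Implies `RestorationQP`
(VP families have `s, d = poly(n)`); admits induction on `s` in shape only (census §Strengthen). -/
def PointwiseRestorationQP : Prop :=
  ∃ c : ℕ, ∀ (n : ℕ) (p : MvPolynomial (Fin n × Fin n) ℂ),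
    (∀ σ : Equiv.Perm (Fin n), MvPolynomial.rename (fun x : Fin n × Fin n => σ • x) p = p) →
    ∀ (G : Type) [Fintype G] (C : LabelledArithCircuit ℂ (Fin n × Fin n) Unit G),
      C.eval (C.output ()) = p →
      ∃ (G' : Type) (_ : Fintype G') (C' : LabelledArithCircuit ℂ (Fin n × Fin n) Unit G'),
        C'.IsSymmetric (Equiv.Perm (Fin n)) ∧ C'.eval (C'.output ()) = p ∧
        Fintype.card G' ≤ 2 ^ ((Nat.log 2 (Fintype.card G + p.totalDegree + n) + c) ^ c)

/-! ## Decomposition attempt D1: the orbit cut  `RestorationQP ⟸ OrbitRestorationDiag ∧ OrbitCompressionDiag` -/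

/-- D1, piece 1: orbit-form restoration for DIAGONALLY invariant VP families (conclusion bounds
Dawar–Wilsenach ORBIT size, not total size). -/
def OrbitRestorationDiagQP : Prop :=
  ∀ f : (n : ℕ) → MvPolynomial (Fin n × Fin n) ℂ,
    (∀ (n : ℕ) (σ : Equiv.Perm (Fin n)), MvPolynomial.rename (fun x : Fin n × Fin n => σ • x) (f n) = f n) →
    IsVPFamily f →
    ∃ c : ℕ, ∀ n : ℕ, ∃ (G : Type) (_ : Fintype G) (C : LabelledArithCircuit ℂ (Fin n × Fin n) Unit G),
      C.IsSymmetric (Equiv.Perm (Fin n)) ∧ C.eval (C.output ()) = f n ∧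
      C.orbitSize (Equiv.Perm (Fin n)) ≤ 2 ^ ((Nat.log 2 n + c) ^ c)

/-- D1, piece 2: orbit-to-size compression for diagonally invariant VP families. -/
def OrbitCompressionDiagQP : Prop :=
  ∀ f : (n : ℕ) → MvPolynomial (Fin n × Fin n) ℂ,
    (∀ (n : ℕ) (σ : Equiv.Perm (Fin n)), MvPolynomial.rename (fun x : Fin n × Fin n => σ • x) (f n) = f n) →
    IsVPFamily f →
    (∃ c : ℕ, ∀ n : ℕ, ∃ (G : Type) (_ : Fintype G) (C : LabelledArithCircuit ℂ (Fin n × Fin n) Unit G),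
      C.IsSymmetric (Equiv.Perm (Fin n)) ∧ C.eval (C.output ()) = f n ∧
      C.orbitSize (Equiv.Perm (Fin n)) ≤ 2 ^ ((Nat.log 2 n + c) ^ c)) →
    ∃ c : ℕ, ∀ n : ℕ, ∃ (G : Type) (_ : Fintype G) (C : LabelledArithCircuit ℂ (Fin n × Fin n) Unit G),
      C.IsSymmetric (Equiv.Perm (Fin n)) ∧ C.eval (C.output ()) = f n ∧
      Fintype.card G ≤ 2 ^ ((Nat.log 2 n + c) ^ c)

/-- The orbit cut composes to the crux (trivial seam). -/
theorem restorationQP_of_orbitCut (h₁ : OrbitRestorationDiagQP) (h₂ : OrbitCompressionDiagQP) :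
    ProofCarryingSymmetry.RestorationQP := by
  intro f hf hvp
  exact h₂ f hf hvp (h₁ f hf hvp)

/-- Piece 1 is implied by the crux (orbit size ≤ size). -/
theorem orbitRestorationDiagQP_of_restorationQP (h : ProofCarryingSymmetry.RestorationQP) :
    OrbitRestorationDiagQP := by
  intro f hf hvp
  obtain ⟨c, hc⟩ := h f hf hvp
  refine ⟨c, fun n => ?_⟩
  obtain ⟨G, hG, C, hsym, hev, hcard⟩ := hc n
  refine ⟨G, hG, C, hsym, hev, le_trans ?_ hcard⟩
  have := C.orbitSize_le_size (Equiv.Perm (Fin n))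
  simpa [LabelledArithCircuit.size] using this

/-- Piece 1 already implies the sibling route's deciding crux `MonotoneRestoration.OrbitRestorationQP`
(matrix-symmetric families are diagonally invariant) … -/
theorem orbitRestorationQP_sibling_of_diag (h : OrbitRestorationDiagQP) :
    MonotoneRestoration.OrbitRestorationQP := by
  intro f hf hvp
  refine h f (fun n σ => ?_) hvp
  have := hf n σ σ
  have hfun : (fun x : Fin n × Fin n => σ • x) = (fun p : Fin n × Fin n => (σ p.1, σ p.2)) := by
    funext p
    rfl
  rw [hfun]
  exact this

/-- … hence piece 1 ALONE decides the summit (via the sibling's `closes`), so D1 is not an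
admissible strategist decomposition ("no piece gives S on its own" fails); it is a re-glue /
re-target for the tenure planner (shared decl = sibling item stmt-ValiantsHypothesis-18293). -/
theorem orbitCut_piece1_decides (h : OrbitRestorationDiagQP) : _root_.ValiantsHypothesis :=
  MonotoneRestoration.closes (orbitRestorationQP_sibling_of_diag h)

/-! ## Decomposition attempt D2: equivariant determinantal representations (E1 ∧ E2) -/

/-- E1: every diagonally invariant VP family has quasi-polynomial CONJUGATION-EQUIVARIANT affine
determinantal representations `f n = det M`, `M(σ • x) = P_π M(x) P_πᵀ`.  Census §Decomposition:
E1 ⟸ RestorationQP by a functorial circuit→formula→ABP→det chain (char 0, qp loss) and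
E1 ⟹ RestorationQP by E2, so E1 is the crux in costume. -/
def EquivDetRepQP : Prop :=
  ∀ f : (n : ℕ) → MvPolynomial (Fin n × Fin n) ℂ,
    (∀ (n : ℕ) (σ : Equiv.Perm (Fin n)), MvPolynomial.rename (fun x : Fin n × Fin n => σ • x) (f n) = f n) →
    IsVPFamily f →
    ∃ c : ℕ, ∀ n : ℕ, ∃ (m : ℕ) (M : Matrix (Fin m) (Fin m) (MvPolynomial (Fin n × Fin n) ℂ)),
      m ≤ 2 ^ ((Nat.log 2 n + c) ^ c) ∧ (∀ i j, (M i j).totalDegree ≤ 1) ∧ M.det = f n ∧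
      ∀ σ : Equiv.Perm (Fin n), ∃ π : Equiv.Perm (Fin m),
        ∀ i j, MvPolynomial.rename (fun x : Fin n × Fin n => σ • x) (M i j) = M (π i) (π j)

/-- E2: a conjugation-equivariant affine determinantal representation of size `m` yields an
`S_n`-symmetric circuit of size polynomial in `m + n` (Dawar–Wilsenach 2025 Thm 4.1-type symmetric
determinant circuits in characteristic 0, composed with the equivariant substitution).  Plausibly
provable; not the hard half. -/
def SymCircuitOfEquivDetRep : Prop :=
  ∃ c : ℕ, ∀ (n m : ℕ) (M : Matrix (Fin m) (Fin m) (MvPolynomial (Fin n × Fin n) ℂ)),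
    (∀ i j, (M i j).totalDegree ≤ 1) →
    (∀ σ : Equiv.Perm (Fin n), ∃ π : Equiv.Perm (Fin m),
        ∀ i j, MvPolynomial.rename (fun x : Fin n × Fin n => σ • x) (M i j) = M (π i) (π j)) →
    ∃ (G : Type) (_ : Fintype G) (C : LabelledArithCircuit ℂ (Fin n × Fin n) Unit G),
      C.IsSymmetric (Equiv.Perm (Fin n)) ∧ C.eval (C.output ()) = M.det ∧
      Fintype.card G ≤ (m + n + 2) ^ c

/- D2 composes to the crux by a trivial seam (`h₂` applied to the output of `h₁`, the size
bound `(m + n + 2)^d` with `m ≤ 2^((log₂ n + c)^c)` being re-absorbed into one exponent); the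
arithmetic is omitted here because D2 is withdrawn as a costume (E1 ≡ crux), see the census. -/

/-! ## Weaker-intermediate rung W3: the low-degree regime (trivially true, leaves the crux whole) -/

/-- Families of polylogarithmic degree restore for free (orbit-sum the monomials: at most
`(n² + 1)^d = 2^{polylog}` of them); recorded to show the degree-regime split has an empty easy side. -/
def RestorationLowDegreeQP : Prop :=
  ∀ f : (n : ℕ) → MvPolynomial (Fin n × Fin n) ℂ,
    (∀ (n : ℕ) (σ : Equiv.Perm (Fin n)), MvPolynomial.rename (fun x : Fin n × Fin n => σ • x) (f n) = f n) →
    (∃ c : ℕ, ∀ n : ℕ, (f n).totalDegree ≤ (Nat.log 2 n + c) ^ c) →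
    ∃ c : ℕ, ∀ n : ℕ, ∃ (G : Type) (_ : Fintype G) (C : LabelledArithCircuit ℂ (Fin n × Fin n) Unit G),
      C.IsSymmetric (Equiv.Perm (Fin n)) ∧ C.eval (C.output ()) = f n ∧
      Fintype.card G ≤ 2 ^ ((Nat.log 2 n + c) ^ c)

end Summit.ValiantsHypothesis.ValiantsHypothesis.Cruxes.RestorationQP.CensusS11
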